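import Summits.ResolutionOfSingularities.ResolutionOfSingularities.Theorems.RadicialJungCleanModelsLens5PRankTwoPort5
import Summits.ResolutionOfSingularities.ResolutionOfSingularities.Theorems.RadicialJungCleanModelsLens5PRankTwoPort2bOfThm11
import HarnessLib

/-!
# RadicialJungCleanModelsLens5PRankTwoPort5 — re-threaded through Cossart–Piltant 2019 Thm. 1.1 (i)–(iii) (`_thm11` variants)

Route `RadicialJung`, crux `CleanModels` (stmt-ResolutionOfSingularities-15917), line `Sketch`.  The declarations below are the
tree's theorems of the same names WITHOUT the suffix `_thm11` (file `RadicialJungCleanModelsLens5PRankTwoPort5.lean`), with the embedded-resolution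
HYPOTHESIS `hEmb` (CJS 2020 Cor. 1.5 shape; skeleton stub `stub_cjs2020Thm14` = F-32) REPLACED by the typed verbatim
Cossart–Piltant 2019 Thm. 1.1 (i)–(iii) `CP2019.CossartPiltant2019Thm11`, through the doubling trick
(`Doubling.hEmb_zeroLocus_of_thm11`, `exists_localRing_monomial_of_thm11_dim`).  Proof bodies are the tree's, verbatim — credit to
the original file and its authors (res-B-lens-5, res-B-lead-1 and workers); only the binder and the threaded call differ.  
OURS; nothing here proves resolution in characteristic `p`.
-/

noncomputable section

set_option linter.dupNamespace false -- mandated namespace of this single-conjunct summit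

open IsLocalRing
open Literature.AlgebraicGeometry.Resolution
open Summit.ResolutionOfSingularities.ResolutionOfSingularities.Theorems.RadicialJung.CleanModels
open Summit.ResolutionOfSingularities.ResolutionOfSingularities.Theorems.RadicialJung.CleanModels.Lens5

open Summit.ResolutionOfSingularities.ResolutionOfSingularities.Theorems.RadicialJung.CleanModels.Lens5.PRankTwoCurrency

namespace Summit.ResolutionOfSingularities.ResolutionOfSingularities.Theorems.RadicialJung.CleanModels.Lens5.PRankTwoAssembly

set_option linter.unusedVariables false

/-! ## §4 THE COMPOSITION (kernel-checked, no sorry): the four port obligations give THEOREM T's slice -/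

section Composition

open AlgebraicGeometry CategoryTheory

/-- **THEOREM T's slice from the four port obligations** — modulo F-02 in its LU³ form (`hLU3 = CossartPiltant2019LU3.{0}`, e.g.
`fun k _ => hCP.lu3 k`) and F-32 (`hEmb`, the embedded-resolution input of CJS monomialisation, verbatim the binder of
✓ `TwistModel.monomialise_on_twist_model`).  SORRY-FREE; the only `sorry` it depends on in THIS file is the placeholder of PORT 3-L
`port_toricChart_lattice`, PROVED (rev 7) with the identical statement in the companion `Lens5_PRankTwoLattice.lean` — all other ports are proved above.  Data flow = memo §5: §1 graded data → §2 monomialising model of `K^p(g₀)` (monomialising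
`x^p`, `y^p` and every non-zero graded coefficient of the generators of `A`) → §3 toric chart (value-zero chart vectors land in `M` by (PB0))
→ §13 regular chart algebra with a regular parameter `ψ ∈ M = K^p(g₀)` → exit lemma, clean form (3).  The slice hypotheses `hreg`
(regularity of the input model) and `hnd` (`v` not discrete of rank one) are not used. [folklore] -/
theorem cleanLU3DefectPRankTwoAt_of_portStubs_thm11 (p : ℕ) [Fact p.Prime]
    (hLU3 : ∀ (k : Type) [Field k], LocalUniformization3 k)
    (h11 : Literature.AlgebraicGeometry.CossartPiltant200819.CP2019.CossartPiltant2019Thm11.{0}) :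
    CleanLU3DefectPRankTwoAt p := by
  intro k _ _ _ K _ _ O A hAO hAfg hFrac hdimA hreg hdim3 hzd g₀ hg₀ hdefect htd hnd hP2
  classical
  haveI := hFrac
  -- §1 graded data
  obtain ⟨M, hM, hg₀M, hpM, hV, x, y, hx, hy, hvx, hvy, hP, t, ht, cf, hcfM, hsum, hcfO⟩ :=
    port_gradedData p O A hAO hAfg hdimA hdim3 g₀ hg₀ hdefect hP2
  -- the finite set to monomialise: `x^p`, `y^p` and the non-zero graded coefficients of the generators
  set F : Finset K := (insert (x ^ p) (insert (y ^ p)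
    ((t ×ˢ (Finset.univ : Finset (Fin p × Fin p))).image (fun q => cf q.1 q.2)))).filter (fun f => f ≠ 0) with hFdef
  have hFM : ∀ f ∈ F, f ∈ M := by
    intro f hf
    rw [hFdef, Finset.mem_filter, Finset.mem_insert, Finset.mem_insert, Finset.mem_image] at hf
    rcases hf with ⟨rfl | rfl | ⟨q, hq, rfl⟩, -⟩
    · exact hpM x
    · exact hpM y
    · exact hcfM q.1 (Finset.mem_product.mp hq).1 q.2
  have hF0 : ∀ f ∈ F, f ≠ 0 := fun f hf => (Finset.mem_filter.mp hf).2
  have hxpF : x ^ p ∈ F := Finset.mem_filter.mpr ⟨by simp, pow_ne_zero _ hx⟩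
  have hypF : y ^ p ∈ F := Finset.mem_filter.mpr ⟨by simp, pow_ne_zero _ hy⟩
  have hcfF : ∀ a ∈ t, ∀ ab, cf a ab ≠ 0 → cf a ab ∈ F := by
    intro a ha ab hne
    refine Finset.mem_filter.mpr ⟨Finset.mem_insert_of_mem (Finset.mem_insert_of_mem ?_), hne⟩
    exact Finset.mem_image.mpr ⟨(a, ab), Finset.mem_product.mpr ⟨ha, Finset.mem_univ _⟩, rfl⟩
  -- §2 the monomialising model of the twist field
  obtain ⟨A₂, hA₂O, hA₂fg, hApA₂, hA₂M, hreg₂, z, hz, hdimT, hmono⟩ :=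
    port_monomialModel_thm11 p (hLU3 k) h11 O A hAO hAfg hdimA hdim3 hzd g₀ M hM F hFM hF0
  haveI := hreg₂
  choose! ε ex hεT hεv hfeq using hmono
  have hrsop : IsRsopPart z := ⟨hreg₂, 0, Fin.elim0, by simpa using hdimT, by simpa using hz⟩
  have hz0 : ∀ i, (z i : K) ≠ 0 := fun i h => hrsop.ne_zero i (Subtype.ext h)
  have hzv : ∀ i, O.valuation (z i : K) < 1 := by
    intro i
    have hzi : z i ∈ maximalIdeal (locAtCentre A₂.toSubring O) := by
      rw [← hz]; exact Ideal.subset_span ⟨i, rfl⟩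
    exact (mem_maximalIdeal_locAtCentre_iff hA₂O (z i)).mp hzi
  have hzM : ∀ i, (z i : K) ∈ M := fun i => hA₂M _ (z i).2
  have hzV : ∀ i, ∃ w : K, w ≠ 0 ∧ O.valuation (z i : K) = O.valuation (w ^ p) :=
    fun i => hV _ (hzM i) (hz0 i)
  have hxA : x ^ p = ε (x ^ p) * ∏ i, (z i : K) ^ ex (x ^ p) i := hfeq _ hxpF
  have hyB : y ^ p = ε (y ^ p) * ∏ i, (z i : K) ^ ex (y ^ p) i := hfeq _ hypF
  -- exponent data of the non-zero graded pieces
  set pieces : Finset (K × (Fin p × Fin p)) := (t ×ˢ Finset.univ).filter (fun q => cf q.1 q.2 ≠ 0) with hpieces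
  set E : Finset ((Fin 3 → ℤ) × (Fin p × Fin p)) := pieces.image (fun q => (ex (cf q.1 q.2), q.2)) with hEdef
  have hE : ∀ e ∈ E, O.valuation ((∏ i, (z i : K) ^ e.1 i) * (x ^ (e.2.1 : ℕ) * y ^ (e.2.2 : ℕ))) ≤ 1 := by
    intro e he
    obtain ⟨q, hq, rfl⟩ := Finset.mem_image.mp he
    obtain ⟨hq1, hq2⟩ := Finset.mem_filter.mp hq
    have hat : q.1 ∈ t := (Finset.mem_product.mp hq1).1
    have hF' : cf q.1 q.2 ∈ F := hcfF q.1 hat q.2 hq2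
    have hval : O.valuation (cf q.1 q.2 * (x ^ (q.2.1 : ℕ) * y ^ (q.2.2 : ℕ))) ≤ 1 :=
      (O.valuation_le_one_iff _).mpr (hcfO q.1 hat q.2)
    rw [hfeq _ hF', mul_assoc, map_mul, hεv _ hF', one_mul] at hval
    simpa using hval
  -- §3 the toric chart
  obtain ⟨ρ, hρ, c, a, b, u, ha, hb, hu, hupos, huzero, hzu, hEu⟩ :=
    port_toricChart p O A hAO hAfg hdimA hdim3 htd hx hy hP (fun i => (z i : K)) hz0 hzv hzV (ε (x ^ p)) (ε (y ^ p))
      (hεv _ hxpF) (hεv _ hypF) (ex (x ^ p)) (ex (y ^ p)) hxA hyB E hE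
  -- (PB0): the value-zero chart monomials involve no `x`, `y`, hence lie in `M`
  have hab0 : ∀ j : Fin 3, ρ ≤ (j : ℕ) → a j = 0 ∧ b j = 0 := by
    intro j hj
    obtain ⟨W, hW0, hW⟩ := exists_valuation_prod_zpow_eq O (fun i => (z i : K)) hzV (c j)
    exact exponents_eq_zero_of_valuation_eq_one O hP (ha j) (hb j) hW0 hW (by rw [← hu j]; exact huzero j hj)
  have huM : ∀ j : Fin 3, ρ ≤ (j : ℕ) → u j ∈ M := by
    intro j hj
    obtain ⟨ha0, hb0⟩ := hab0 j hj
    rw [hu j, ha0, hb0, pow_zero, pow_zero, mul_one, mul_one]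
    exact prod_mem fun i _ => zpow_mem (hzM i) _
  have hu0 : ∀ j, u j ≠ 0 := by
    intro j
    rw [hu j]
    exact mul_ne_zero (Finset.prod_ne_zero_iff.mpr fun i _ => zpow_ne_zero _ (hz0 i))
      (mul_ne_zero (pow_ne_zero _ hx) (pow_ne_zero _ hy))
  -- the unit factors `α^i β^j` are units of `T`
  have hunit : ∀ ia ib : ℤ, ε (x ^ p) ^ ia * ε (y ^ p) ^ ib ∈ locAtCentre A₂.toSubring O ∧
      O.valuation (ε (x ^ p) ^ ia * ε (y ^ p) ^ ib) = 1 := fun ia ib =>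
    ⟨mul_mem (zpow_mem_locAtCentre (hεT _ hxpF) (hεv _ hxpF) ia) (zpow_mem_locAtCentre (hεT _ hypF) (hεv _ hypF) ib),
      by rw [map_mul, map_zpow₀, map_zpow₀, hεv _ hxpF, hεv _ hypF, one_zpow, one_zpow, one_mul]⟩
  have hzu' : ∀ i : Fin 3, ∃ (ε' : K) (d : Fin 3 → ℤ), ε' ∈ locAtCentre A₂.toSubring O ∧ O.valuation ε' = 1 ∧
      (∀ j : Fin 3, (j : ℕ) < ρ → 0 ≤ d j) ∧ (∃ j : Fin 3, (j : ℕ) < ρ ∧ 0 < d j) ∧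
      ((z i : K)) = ε' * ∏ j, u j ^ d j := by
    intro i
    obtain ⟨d, ia, ib, hd, hdpos, hzi⟩ := hzu i
    exact ⟨_, d, (hunit ia ib).1, (hunit ia ib).2, hd, hdpos, hzi⟩
  -- the generators of `A` as unit-weighted sums of chart monomials with `d_{<ρ} ≥ 0`
  choose! dE iaE ibE hdE hkerE hmonE using hEu
  have htu' : ∀ a₀ ∈ t, ∃ (ν : Fin p × Fin p → K) (d : Fin p × Fin p → Fin 3 → ℤ),
      (∀ l, ν l = 0 ∨ (ν l ∈ locAtCentre A₂.toSubring O ∧ O.valuation (ν l) = 1)) ∧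
      (∀ l, ∀ j : Fin 3, (j : ℕ) < ρ → 0 ≤ d l j) ∧ a₀ = ∑ l, ν l * ∏ j, u j ^ d l j := by
    intro a₀ ha₀
    have hmemE : ∀ ab, cf a₀ ab ≠ 0 → (ex (cf a₀ ab), ab) ∈ E := fun ab hne =>
      Finset.mem_image.mpr ⟨(a₀, ab), Finset.mem_filter.mpr ⟨Finset.mem_product.mpr ⟨ha₀, Finset.mem_univ _⟩, hne⟩, rfl⟩
    refine ⟨fun ab => if cf a₀ ab = 0 then 0 else
        ε (cf a₀ ab) * (ε (x ^ p) ^ iaE (ex (cf a₀ ab), ab) * ε (y ^ p) ^ ibE (ex (cf a₀ ab), ab)),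
      fun ab => if cf a₀ ab = 0 then 0 else dE (ex (cf a₀ ab), ab), ?_, ?_, ?_⟩
    · intro ab
      by_cases h0 : cf a₀ ab = 0
      · exact Or.inl (by simp [h0])
      · refine Or.inr ?_
        simp only [h0, if_false]
        have hF' := hcfF a₀ ha₀ ab h0
        exact ⟨mul_mem (hεT _ hF') (hunit _ _).1, by rw [map_mul, hεv _ hF', (hunit _ _).2, one_mul]⟩
    · intro ab j hj
      by_cases h0 : cf a₀ ab = 0
      · simp [h0]
      · simp only [h0, if_false]
        exact hdE _ (hmemE ab h0) j hj
    · conv_lhs => rw [← hsum a₀ ha₀]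
      refine Finset.sum_congr rfl fun ab _ => ?_
      by_cases h0 : cf a₀ ab = 0
      · simp [h0]
      · simp only [h0, if_false]
        have hF' := hcfF a₀ ha₀ ab h0
        have hmon := hmonE _ (hmemE ab h0)
        simp only at hmon
        calc cf a₀ ab * (x ^ (ab.1 : ℕ) * y ^ (ab.2 : ℕ))
            = (ε (cf a₀ ab) * ∏ i, (z i : K) ^ ex (cf a₀ ab) i) * (x ^ (ab.1 : ℕ) * y ^ (ab.2 : ℕ)) := by
              rw [← hfeq _ hF']
          _ = ε (cf a₀ ab) * ((∏ i, (z i : K) ^ ex (cf a₀ ab) i) * (x ^ (ab.1 : ℕ) * y ^ (ab.2 : ℕ))) := by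
              rw [mul_assoc]
          _ = ε (cf a₀ ab) * (ε (x ^ p) ^ iaE (ex (cf a₀ ab), ab) * ε (y ^ p) ^ ibE (ex (cf a₀ ab), ab)) *
                ∏ j, u j ^ dE (ex (cf a₀ ab), ab) j := by
              rw [hmon]; ring
  -- §13 the regular chart algebra and its regular parameter in `M`
  obtain ⟨A'', hA''O, hAA'', hA''fg, hreg'', ψ, hψ1, hψ2, hψM⟩ :=
    port_regularParameter p O A hAO hAfg hdimA hdim3 hzd M A₂ hA₂O hA₂fg hApA₂ hA₂M hreg₂ z hz hdimT t ht ρ hρ u hu0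
      hupos huzero huM hzu' htu'
  -- exit: clean form (3)
  obtain ⟨cM, hcM⟩ := (hM _).mp hψM
  exact cleanLUConcl_of_parameter O A A'' hA''O hAA'' hA''fg hreg'' g₀ ψ hψ1 hψ2 cM hcM

/-- The same, with F-02 consumed in its main-theorem form `CossartPiltant2019` (LU³ by ✓ `CossartPiltant2019.lu3`). [folklore] -/
theorem cleanLU3DefectPRankTwoAt_of_cossartPiltant2019_thm11 (p : ℕ) [Fact p.Prime]
    (hCP : CossartPiltant2019.{0})
    (h11 : Literature.AlgebraicGeometry.CossartPiltant200819.CP2019.CossartPiltant2019Thm11.{0}) :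
    CleanLU3DefectPRankTwoAt p :=
  cleanLU3DefectPRankTwoAt_of_portStubs_thm11 p (fun k _ => hCP.lu3 k) h11

/-- **THEOREM T's slice, DEF-FREE** (the three currency definitions `CleanLU3DefectPRankTwoAt`, `PRankTwoAt`, `CleanLUConcl` unfolded): the statement
of the research stub `stub_cleanLU3DefectNonDiscrete` of `Cruxes/CleanModels/Lines/Sketch.lean` on the slice {`PerfectField k`, `[Γ : pΓ] = p²`},
modulo F-02 (`CossartPiltant2019`) and F-32 (`hEmb`).  This is the declaration the skeleton cites (rev 26). [folklore] -/
theorem cleanLU3DefectPRankTwo_of_cossartPiltant2019_thm11 (p : ℕ) [Fact p.Prime]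
    (hCP : CossartPiltant2019.{0})
    (h11 : Literature.AlgebraicGeometry.CossartPiltant200819.CP2019.CossartPiltant2019Thm11.{0}) :
    ∀ (k : Type) [Field k] [CharP k p] [PerfectField k] (K : Type) [Field K] [Algebra k K]
    (O : ValuationSubring K) (A : Subalgebra k K), A.toSubring ≤ O.toSubring → A.FG → IsFractionRing A K →
    ringKrullDim A ≤ 3 → IsRegularLocalRing (locAtCentre A.toSubring O) →
    ringKrullDim (locAtCentre A.toSubring O) = 3 →
    (∀ (T : Subring K) (hT : T ≤ O.toSubring), A.toSubring ≤ T → (subringCentre T O hT).IsMaximal) →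
    ∀ g₀ : K, (∀ c : K, c ^ p ≠ g₀) →
    (∀ f₀ : K, ∃ f₁ : K, O.valuation (g₀ - f₁ ^ p) < O.valuation (g₀ - f₀ ^ p)) →
    (∀ hk : ∀ c : k, algebraMap k K c ∈ O, transcendenceDefect k O hk ≠ 0) →
    ¬ (∃ π : K, π ≠ 0 ∧ (∀ x : K, O.valuation x < 1 → O.valuation x ≤ O.valuation π) ∧
      (∀ x : K, x ≠ 0 → ∃ n : ℕ, O.valuation π ^ n ≤ O.valuation x)) →
    (∃ x y : K, x ≠ 0 ∧ y ≠ 0 ∧ ∀ a b : ℕ, a < p → b < p → (a ≠ 0 ∨ b ≠ 0) →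
      ∀ z : K, z ≠ 0 → O.valuation (x ^ a * y ^ b) ≠ O.valuation (z ^ p)) →
    ∃ (A' : Subalgebra k K), A'.toSubring ≤ O.toSubring ∧ A ≤ A' ∧ A'.FG ∧
      ∃ (_ : IsRegularLocalRing (locAtCentre A'.toSubring O)) (c : Fin p → K),
        (∃ j : Fin p, (j : ℕ) ≠ 0 ∧ c j ≠ 0) ∧
        ((∃ (d m : ℕ) (hmd : m ≤ d) (t : Fin d → ↥(locAtCentre A'.toSubring O)) (a : Fin m → ℕ)
            (u : ↥(locAtCentre A'.toSubring O)), IsUnit u ∧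
            Ideal.span (Set.range t) = IsLocalRing.maximalIdeal ↥(locAtCentre A'.toSubring O) ∧
            ringKrullDim ↥(locAtCentre A'.toSubring O) = (d : WithBot ℕ∞) ∧ 0 < m ∧ (∀ i, ¬ p ∣ a i) ∧
            (∑ j : Fin p, c j ^ p * g₀ ^ (j : ℕ)) =
              (u : K) * ∏ i : Fin m, ((t (Fin.castLE hmd i) : ↥(locAtCentre A'.toSubring O)) : K) ^ (a i)) ∨
          (∃ u : ↥(locAtCentre A'.toSubring O), IsUnit u ∧ (∑ j : Fin p, c j ^ p * g₀ ^ (j : ℕ)) = (u : K) ∧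
            ∀ c' : ↥(locAtCentre A'.toSubring O), u - c' ^ p ∉ IsLocalRing.maximalIdeal ↥(locAtCentre A'.toSubring O)) ∨
          (∃ s c' : ↥(locAtCentre A'.toSubring O), (∑ j : Fin p, c j ^ p * g₀ ^ (j : ℕ)) = (s : K) ∧
            s - c' ^ p ∈ IsLocalRing.maximalIdeal ↥(locAtCentre A'.toSubring O) ∧
            s - c' ^ p ∉ IsLocalRing.maximalIdeal ↥(locAtCentre A'.toSubring O) ^ 2)) := by
  intro k _ _ _ K _ _ O A hAO hAfg hfrac hdimA hreg hdim3 hzd g₀ hg₀ hdefect htd hdisc hP2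
  exact cleanLU3DefectPRankTwoAt_of_cossartPiltant2019_thm11 p hCP h11 k K O A hAO hAfg hfrac hdimA hreg hdim3 hzd g₀ hg₀ hdefect htd hdisc hP2

end Composition

end Summit.ResolutionOfSingularities.ResolutionOfSingularities.Theorems.RadicialJung.CleanModels.Lens5.PRankTwoAssembly

end
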